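import Summits.ResolutionOfSingularities.ResolutionOfSingularities.Theorems.FrobeniusLadderFInjectiveMacaulayficationHypersurfaceRegular
import Summits.ResolutionOfSingularities.ResolutionOfSingularities.Theorems.FrobeniusLadderFInjectiveMacaulayficationFiClauseOfRegular
import Mathlib.Algebra.MvPolynomial.PDeriv
import Mathlib.Algebra.CharP.Algebra
import HarnessLib

/-!
# The `x`-chart of `Bl_𝔪 E₈⁰` (characteristic `5`) is regular along the exceptional divisor

Support file for crux stmt-ResolutionOfSingularities-15315 (`FrobeniusLadder.FInjectiveMacaulayfication`,
line `Sketch`, lead seat c4, cycle 5, wave 3): stub `stub_e8ChartXPoints` of the §7 CALIBRATION package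
(the point blow-up `Bl_𝔪 E₈⁰` of `E₈⁰ : z² + x³ + y⁵ = 0` in characteristic `5`, certified through the
blow-up glue E6′).

The `x`-chart of the blow-up is the hypersurface ring `S/(gₓ)`, `S = k[X₀, X₁, X₂]`,
`gₓ = X₂² + X₀ + X₀³X₁⁵` (upstairs `X₀ = x` is the equation of the exceptional divisor `E`, `X₁ = y/x`,
`X₂ = z/x`). The blow-up glue needs the Cohen–Macaulay + Frobenius-closed clause of the crux (inline form,
`p = 5`) at the local ring `(S/(gₓ))_Q` of every MAXIMAL ideal `Q` of `S/(gₓ)` on `E` (`X̄₀ ∈ Q`). Every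
such point is REGULAR, by the Jacobian criterion in the `X₀`-direction:

* `pderiv_zero_gx` — `∂gₓ/∂X₀ = 1 + X₀ · (3 X₀ X₁⁵)`.
* `pderiv_zero_gx_not_mem` — hence `∂gₓ/∂X₀ ∉ P` for every proper ideal `P ∋ X₀` of `S` (else
  `1 = ∂gₓ/∂X₀ - X₀ · (3 X₀ X₁⁵) ∈ P`).
* `charP_localization_atPrime_quotient` — the local rings `(S/(g))_Q` have characteristic `5` (they are
  non-trivial `k`-algebras, `CharP.of_ringHom_of_ne_zero`).
* `stub_e8ChartXPoints` — the registered form: with `P := Q ∩ S ∋ X₀`, the Jacobian criterion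
  `HypersurfaceRegular.stub_hypersurfaceRegularOfPderiv` (Matsumura Thm. 30.4 (ii), direction `i = 0`) makes
  `(S/(gₓ))_Q` a regular local ring, and `FiClauseOfRegular.stub_fiClauseOfRegular` (`p = 5`: regular
  local rings of prime characteristic satisfy the clause — Matsumura Thm. 17.4 and Kunz) gives the clause.

References: H. Matsumura, *Commutative Ring Theory*, Cambridge Stud. Adv. Math. 8, CUP 1986,
Thm. 30.4 (ii) [Matsumura1987]; the computation of the chart and its derivative is folklore.
-/

-- single-problem summit: the doubled namespace component is forced
set_option linter.dupNamespace false

noncomputable section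

namespace Summit.ResolutionOfSingularities.ResolutionOfSingularities.Theorems.FInjectiveMacaulayfication.E8ChartXPoints

open MvPolynomial

/-- **The derivative of the `x`-chart equation in the exceptional direction**:
`∂(X₂² + X₀ + X₀³X₁⁵)/∂X₀ = 1 + X₀ · (3 X₀ X₁⁵)` in `k[X₀, X₁, X₂]` (any commutative ring `k`). [folklore] -/
theorem pderiv_zero_gx (k : Type) [CommRing k] :
    pderiv 0 (X 2 ^ 2 + X 0 + X 0 ^ 3 * X 1 ^ 5 : MvPolynomial (Fin 3) k) =
      1 + X 0 * (3 * X 0 * X 1 ^ 5) := by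
  simp only [map_add, pderiv_mul, pderiv_pow, pderiv_X_self,
    pderiv_X_of_ne (show (2 : Fin 3) ≠ 0 by decide), pderiv_X_of_ne (show (1 : Fin 3) ≠ 0 by decide),
    Nat.cast_ofNat]
  ring

/-- **The exceptional direction is a regular direction**: for every proper ideal `P ∋ X₀` of `k[X₀, X₁, X₂]`,
`∂gₓ/∂X₀ = 1 + X₀ · (3 X₀ X₁⁵) ∉ P` — otherwise `1 = ∂gₓ/∂X₀ - X₀ · (3 X₀ X₁⁵) ∈ P`. [folklore] -/
theorem pderiv_zero_gx_not_mem (k : Type) [CommRing k] (P : Ideal (MvPolynomial (Fin 3) k))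
    (hP : P ≠ ⊤) (hX : (X 0 : MvPolynomial (Fin 3) k) ∈ P) :
    pderiv 0 (X 2 ^ 2 + X 0 + X 0 ^ 3 * X 1 ^ 5 : MvPolynomial (Fin 3) k) ∉ P := by
  intro hmem
  refine hP ((Ideal.eq_top_iff_one P).mpr ?_)
  have h1 := P.sub_mem hmem (P.mul_mem_right (3 * X 0 * X 1 ^ 5) hX)
  rwa [pderiv_zero_gx, add_sub_cancel_right] at h1

/-- **Local rings of a hypersurface over a field of characteristic `5` have characteristic `5`**: for a prime
`Q` of `k[X₀, X₁, X₂]/(g)`, the localization `(k[X]/(g))_Q` is a non-trivial (local) `k`-algebra, and a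
non-trivial algebra over a field inherits its prime characteristic (`CharP.of_ringHom_of_ne_zero`).
[folklore] -/
theorem charP_localization_atPrime_quotient (k : Type) [Field k] [CharP k 5]
    (g : MvPolynomial (Fin 3) k) (Q : Ideal (MvPolynomial (Fin 3) k ⧸ Ideal.span {g})) [Q.IsPrime] :
    CharP (Localization.AtPrime Q) 5 :=
  CharP.of_ringHom_of_ne_zero (algebraMap k (Localization.AtPrime Q)) 5 (by decide)

/-- **The `x`-chart of `Bl_𝔪 E₈⁰` is regular along the exceptional divisor** (registered stub
`stub_e8ChartXPoints`, wave 3 of the §7 calibration package): for a field `k` of characteristic `5`,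
`gₓ = X₂² + X₀ + X₀³X₁⁵` and every maximal ideal `Q ∋ X̄₀` of `k[X₀, X₁, X₂]/(gₓ)`, the local ring
`(k[X]/(gₓ))_Q` satisfies the crux's clause: every system of parameters is a weakly regular sequence and
generates a Frobenius closed ideal (inline form, `p = 5`). Proof: `P := Q ∩ k[X]` is a proper ideal
containing `X₀`, so `∂gₓ/∂X₀ ∉ P` (`pderiv_zero_gx_not_mem`); the Jacobian criterion
(`HypersurfaceRegular.stub_hypersurfaceRegularOfPderiv`, Matsumura Thm. 30.4 (ii)) makes `(k[X]/(gₓ))_Q`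
regular local, of characteristic `5` (`charP_localization_atPrime_quotient`), and regular local rings of
prime characteristic satisfy the clause (`FiClauseOfRegular.stub_fiClauseOfRegular`).
[cite: Matsumura1987, Thm. 30.4 (ii)] -/
theorem stub_e8ChartXPoints : ∀ (k : Type) [Field k] [CharP k 5] (gx : MvPolynomial (Fin 3) k),
    gx = MvPolynomial.X 2 ^ 2 + MvPolynomial.X 0 + MvPolynomial.X 0 ^ 3 * MvPolynomial.X 1 ^ 5 →
    ∀ (Q : Ideal (MvPolynomial (Fin 3) k ⧸ Ideal.span {gx})) [Q.IsMaximal],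
      Ideal.Quotient.mk (Ideal.span {gx}) (MvPolynomial.X 0) ∈ Q →
      ∀ d : ℕ, ringKrullDim (Localization.AtPrime Q) = d → ∀ s : Fin d → Localization.AtPrime Q,
        (Ideal.span (Set.range s)).radical.IsMaximal →
          RingTheory.Sequence.IsWeaklyRegular (Localization.AtPrime Q) (List.ofFn s) ∧
          ∀ y : Localization.AtPrime Q, (∃ e : ℕ, y ^ 5 ^ e ∈ Ideal.span
            ((fun z : Localization.AtPrime Q => z ^ 5 ^ e) ''
              (Ideal.span (Set.range s) : Set (Localization.AtPrime Q)))) → y ∈ Ideal.span (Set.range s) := by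
  intro k _ _ gx hgx Q hQ hX0 d hd s hs
  subst hgx
  -- the prime `P = Q ∩ k[X]` above `Q` is proper and contains `X₀`, so `∂gₓ/∂X₀ ∉ P`
  have hder := pderiv_zero_gx_not_mem k _ (Ideal.comap_ne_top _ hQ.ne_top) (Ideal.mem_comap.mpr hX0)
  -- Jacobian criterion: the local ring is regular
  haveI : IsRegularLocalRing (Localization.AtPrime Q) :=
    HypersurfaceRegular.stub_hypersurfaceRegularOfPderiv k 3 _ 0 Q hder
  haveI : CharP (Localization.AtPrime Q) 5 := charP_localization_atPrime_quotient k _ Q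
  haveI : Fact (Nat.Prime 5) := ⟨Nat.prime_five⟩
  -- regular local rings of characteristic `5` satisfy the clause
  exact (FiClauseOfRegular.stub_fiClauseOfRegular 5 (Localization.AtPrime Q)).2 d hd s hs

end Summit.ResolutionOfSingularities.ResolutionOfSingularities.Theorems.FInjectiveMacaulayfication.E8ChartXPoints

end
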